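import Summits.QuantumFields.BalabanUV.T4Continuum.Support.NE7CommutingPushForward
import HarnessLib

/-!
# NE7CommutingAverageExp — IN THE U(1) (COMMUTING) SECTOR BAŁABAN'S AVERAGE OF A MULTIPLICATIVELY PERTURBED CONFIGURATION IS THE AVERAGE TIMES THE EXPONENTIAL OF THE FLAT `T`:
# `cavg L (U e^{sψ}) = (cavg L U)·e^{s·Tcoarse L ψ}` EXACTLY, through the whole tower, and the multi-level constraint map is LINEAR: `levelQ L N j U (U e^{sψ}) = skewPR (s·(Tcoarse L)^[j+1] ψ)`

Lineage `b2b-balaban-t4-ne7-p1` (CRUX PROVER NE7 #1 = OWNER of BINDER row NE7), generation 116 — fourth brick of ROAD-G116 §7 (G-ab).  The nonlinear counterpart of ✓ `NE7CommutingPushForward`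
(`pushDir = Tside`): with `hcomm : ∀ a b, Commute a b`, loop radius `‖W_{c,x}[U] − 1‖ ≤ 1/4` and the perturbation inside the logarithmic ball (`‖s·ψ(loop)‖ < ln 2 − 1/2`),
* `Xavg_vary_comm`: `X_c[U e^{sψ}] = X_c[U] + s·X̂_c(ψ)` (✓ `NE7CommutingLogDerivative.mlog_mul_exp_of_commute` termwise in (42));
* **`val_bavg_vary_comm`** ∕ **`cavg_vary_comm`**: `\overline{U e^{sψ}}(c) = Ū(c)·e^{s T_c(ψ)}`, i.e. `cavg L (vary U ψ s) = vary (cavg L U) (Tcoarse L ψ) s` — the abelian exactness of (42)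
  (✓ `AbelianBlockAverage.bavg_expUnit` is the case `U = e^{A}` in a commutative algebra; here any commuting background);
* `relLog_vary`: `log(C⁻¹·C e^{sB}) = s B` inside the ball; **`cavgIter_vary_comm`** (the tower, by induction); **`levelQ_vary_comm`**:
  `levelQ L N j U (vary U ψ s) = skewPR N (res (s • (Tcoarse L)^[j+1] ψ))` — the multi-level constraint map of B11 (115)–(121) is LINEAR along `U e^{sψ}` in the abelian sector.
[folklore]; 0 def, 0 sorry.  HONEST FRAMING: lattice kinematics under an explicit commutation HYPOTHESIS and explicit smallness binders; nothing about Bałaban's minimisers; NOT NE7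
as a spine node; spine 0∕9; NOT infinite volume, NOT mass gap, NOT BetaPertH, NOT Clay.
-/

set_option autoImplicit false

open scoped BigOperators Matrix Matrix.Norms.L2Operator Topology
open NormedSpace Finset Filter

namespace Summit.QuantumFields.BalabanUV.T4Continuum.NE7CommutingAverageExp

open Literature.MathematicalPhysics.QuantumFieldTheory.Balaban1983to89
open B7Prop1Explicit B7Prop2Explicit MatrixLog
open T4AveragingDeficitWall (Ad vary)
open AveragingDeficitTorusChart (TDir chartDir resDir)
open AveragingDeficitChartCalculus (coord cavg relLog)
open AveragingDeficitTwoLevelPrep (skewSub skewPR)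
open AveragingDeficitMultiLevelPrep (tower levelQ cavgIter)
open SmoothRefineNeutral (Tcoarse)
open NE7ConstantFluxBackground (Ad_eq_of_commute)
open NE7CommutingLogDerivative (mlog_mul_exp_of_commute)
open NE7CommutingPushForward (val_hol_vary val_Wcx_vary)

noncomputable section

variable {d : ℕ} {n : Type} [Fintype n] [DecidableEq n]

section Comm

variable (hcomm : ∀ a b : Matrix n n ℂ, Commute a b)
include hcomm

/-! ## §1 The exponent and the average of `U e^{sψ}` -/

/-- **`X_c[U e^{sψ}] = X_c[U] + s·X̂_c(ψ)`** (loop radius `≤ 1/4`, perturbation inside the logarithmic ball). [folklore] -/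
theorem Xavg_vary_comm (L : ℕ) (U : Site d → Fin d → (Matrix n n ℂ)ˣ) (ψ : Site d → Fin d → Matrix n n ℂ) (s : ℝ) (q : Site d) (κ : Fin d)
    (hW : ∀ r : Fin d → Fin L, ‖((Wcx L U q κ (boxVec L r) : (Matrix n n ℂ)ˣ) : Matrix n n ℂ) - 1‖ ≤ 1 / 4)
    (hs : ∀ r : Fin d → Fin L, ‖(s : ℂ) • asum ψ q (gammaWord L κ (boxVec L r) ++ seg κ (-(L : ℤ)))‖ < Real.log 2 - 1 / 2) :
    Xavg L (vary U ψ s) q κ = Xavg L U q κ + (s : ℂ) • Xhat L ψ q κ := by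
  unfold Xavg Xhat
  rw [Finset.smul_sum, ← Finset.sum_add_distrib]
  refine Finset.sum_congr rfl fun r _ => ?_
  have hu : ‖((Wcx L U q κ (boxVec L r) : (Matrix n n ℂ)ˣ) : Matrix n n ℂ) - 1‖ < 1 := by linarith [hW r]
  have hlog : ‖mlog ((Wcx L U q κ (boxVec L r) : (Matrix n n ℂ)ˣ) : Matrix n n ℂ)‖ ≤ 1 / 2 := by
    have h1 := norm_mlog_le_two_mul (X := ((Wcx L U q κ (boxVec L r) : (Matrix n n ℂ)ˣ) : Matrix n n ℂ)) (by linarith [hW r])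
    linarith [hW r]
  have hball : ‖mlog ((Wcx L U q κ (boxVec L r) : (Matrix n n ℂ)ˣ) : Matrix n n ℂ) + (s : ℂ) • asum ψ q (gammaWord L κ (boxVec L r) ++ seg κ (-(L : ℤ)))‖
      < Real.log 2 := by
    refine (norm_add_le _ _).trans_lt ?_
    linarith [hs r]
  rw [val_Wcx_vary hcomm, mlog_mul_exp_of_commute hu (hcomm _ _) hball, smul_add, smul_comm]

/-- **THE AVERAGE OF `U e^{sψ}` IS `Ū·e^{s T(ψ)}`** on every coarse bond (the abelian exactness of (42); `L ≥ 1`, loop radius `≤ 1/4`, perturbation in the ball). [folklore] -/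
theorem val_bavg_vary_comm {L : ℕ} (hL : 1 ≤ L) (U : Site d → Fin d → (Matrix n n ℂ)ˣ) (ψ : Site d → Fin d → Matrix n n ℂ) (s : ℝ) (q : Site d) (κ : Fin d)
    (hW : ∀ r : Fin d → Fin L, ‖((Wcx L U q κ (boxVec L r) : (Matrix n n ℂ)ˣ) : Matrix n n ℂ) - 1‖ ≤ 1 / 4)
    (hs : ∀ r : Fin d → Fin L, ‖(s : ℂ) • asum ψ q (gammaWord L κ (boxVec L r) ++ seg κ (-(L : ℤ)))‖ < Real.log 2 - 1 / 2) :
    ((bavg L (vary U ψ s) q κ : (Matrix n n ℂ)ˣ) : Matrix n n ℂ) = ((bavg L U q κ : (Matrix n n ℂ)ˣ) : Matrix n n ℂ) * exp ((s : ℂ) • Tside L ψ q κ) := by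
  letI : NormedAlgebra ℚ (Matrix n n ℂ) := NormedAlgebra.restrictScalars ℚ ℂ (Matrix n n ℂ)
  have hT : Tside L ψ q κ = Xhat L ψ q κ + asum ψ q (seg κ L) := by rw [Xhat_eq L hL]; abel
  simp only [bavg, Units.val_mul, val_expUnit]
  rw [Xavg_vary_comm hcomm L U ψ s q κ hW hs, val_hol_vary hcomm, hT, smul_add, exp_add_of_commute (hcomm _ _), exp_add_of_commute (hcomm _ _)]
  set A := exp (Xavg L U q κ)
  set B := ((hol U q (seg κ L) : (Matrix n n ℂ)ˣ) : Matrix n n ℂ)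
  set E₁ := exp ((s : ℂ) • Xhat L ψ q κ)
  set E₂ := exp ((s : ℂ) • asum ψ q (seg κ L))
  rw [mul_assoc A E₁, ← mul_assoc E₁ B, (hcomm E₁ B).eq, mul_assoc B E₁, mul_assoc A B]

/-- **`cavg L (U e^{sψ}) = (cavg L U)·e^{s·Tcoarse L ψ}`** as configurations (`L ≥ 1`; at every corner `L•y`: loop radius `≤ 1/4`, perturbation in the ball). [folklore] -/
theorem cavg_vary_comm {L : ℕ} (hL : 1 ≤ L) (U : Site d → Fin d → (Matrix n n ℂ)ˣ) (ψ : Site d → Fin d → Matrix n n ℂ) (s : ℝ)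
    (hW : ∀ (y : Site d) (κ : Fin d) (r : Fin d → Fin L), ‖((Wcx L U ((L : ℤ) • y) κ (boxVec L r) : (Matrix n n ℂ)ˣ) : Matrix n n ℂ) - 1‖ ≤ 1 / 4)
    (hs : ∀ (y : Site d) (κ : Fin d) (r : Fin d → Fin L), ‖(s : ℂ) • asum ψ ((L : ℤ) • y) (gammaWord L κ (boxVec L r) ++ seg κ (-(L : ℤ)))‖ < Real.log 2 - 1 / 2) :
    cavg L (vary U ψ s) = vary (cavg L U) (Tcoarse L ψ) s := by
  funext y κ
  apply Units.ext
  simp only [cavg, vary, Units.val_mul, val_expUnit, Tcoarse]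
  exact val_bavg_vary_comm hcomm hL U ψ s _ κ (hW y κ) (hs y κ)

/-! ## §2 Through the tower; the constraint map is linear -/

/-- **THE TOWER**: `cavgIter L i (U e^{sψ}) = (cavgIter L i U)·e^{s·(Tcoarse L)^[i] ψ}` provided, at every level `m < i`, the averaged background has loop radius `≤ 1/4` and the
transported perturbation lies in the ball. [folklore] -/
theorem cavgIter_vary_comm {L : ℕ} (hL : 1 ≤ L) :
    ∀ (i : ℕ) (U : Site d → Fin d → (Matrix n n ℂ)ˣ) (ψ : Site d → Fin d → Matrix n n ℂ) (s : ℝ),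
      (∀ m < i, ∀ (y : Site d) (κ : Fin d) (r : Fin d → Fin L),
          ‖((Wcx L (cavgIter L m U) ((L : ℤ) • y) κ (boxVec L r) : (Matrix n n ℂ)ˣ) : Matrix n n ℂ) - 1‖ ≤ 1 / 4) →
      (∀ m < i, ∀ (y : Site d) (κ : Fin d) (r : Fin d → Fin L),
          ‖(s : ℂ) • asum ((Tcoarse L)^[m] ψ) ((L : ℤ) • y) (gammaWord L κ (boxVec L r) ++ seg κ (-(L : ℤ)))‖ < Real.log 2 - 1 / 2) →
      cavgIter L i (vary U ψ s) = vary (cavgIter L i U) ((Tcoarse L)^[i] ψ) s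
  | 0, _, _, _, _, _ => rfl
  | i + 1, U, ψ, s, hW, hs => by
      show cavgIter L i (cavg L (vary U ψ s)) = vary (cavgIter L i (cavg L U)) ((Tcoarse L)^[i + 1] ψ) s
      rw [cavg_vary_comm hcomm hL U ψ s (hW 0 (Nat.succ_pos _)) (hs 0 (Nat.succ_pos _)), Function.iterate_succ_apply]
      exact cavgIter_vary_comm hL i (cavg L U) (Tcoarse L ψ) s (fun m hm => hW (m + 1) (by omega)) (fun m hm => hs (m + 1) (by omega))

omit hcomm in
/-- **`log (C⁻¹·C e^{sB}) = s B`** on the torus bonds, inside the ball. [folklore] -/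
theorem relLog_vary (M : ℕ) (C : Site d → Fin d → (Matrix n n ℂ)ˣ) (B : Site d → Fin d → Matrix n n ℂ) (s : ℝ)
    (hB : ∀ (r : Fin d → Fin M) (κ : Fin d), ‖(s : ℂ) • B (boxVec M r) κ‖ < Real.log 2) :
    relLog M C (vary C B s) = fun r κ => (s : ℂ) • B (boxVec M r) κ := by
  funext r κ
  simp only [relLog, vary, Units.val_mul, val_expUnit, Units.inv_mul_cancel_left]
  exact B7BlockAvgLog.mlog_exp (hB r κ)

/-- **THE MULTI-LEVEL CONSTRAINT MAP IS LINEAR ALONG `U e^{sψ}` IN THE ABELIAN SECTOR**: `levelQ L N j U (vary U ψ s) = skewPR N (r κ ↦ s·(Tcoarse L)^[j+1] ψ (boxVec N r) κ)`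
(loop radii `≤ 1/4` and transported perturbation in the ball at the levels `m ≤ j`; transported perturbation in the ball `ln 2` on the top torus). [folklore] -/
theorem levelQ_vary_comm {L : ℕ} (hL : 1 ≤ L) (N j : ℕ) (U : Site d → Fin d → (Matrix n n ℂ)ˣ) (ψ : Site d → Fin d → Matrix n n ℂ) (s : ℝ)
    (hW : ∀ m ≤ j, ∀ (y : Site d) (κ : Fin d) (r : Fin d → Fin L),
        ‖((Wcx L (cavgIter L m U) ((L : ℤ) • y) κ (boxVec L r) : (Matrix n n ℂ)ˣ) : Matrix n n ℂ) - 1‖ ≤ 1 / 4)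
    (hs : ∀ m ≤ j, ∀ (y : Site d) (κ : Fin d) (r : Fin d → Fin L),
        ‖(s : ℂ) • asum ((Tcoarse L)^[m] ψ) ((L : ℤ) • y) (gammaWord L κ (boxVec L r) ++ seg κ (-(L : ℤ)))‖ < Real.log 2 - 1 / 2)
    (htop : ∀ (r : Fin d → Fin N) (κ : Fin d), ‖(s : ℂ) • (Tcoarse L)^[j + 1] ψ (boxVec N r) κ‖ < Real.log 2) :
    levelQ L N j U (vary U ψ s) = skewPR N (fun r κ => (s : ℂ) • (Tcoarse L)^[j + 1] ψ (boxVec N r) κ) := by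
  unfold levelQ
  rw [cavgIter_vary_comm hcomm hL (j + 1) U ψ s (fun m hm => hW m (by omega)) (fun m hm => hs m (by omega)),
    relLog_vary N _ _ s htop]

end Comm

end

end Summit.QuantumFields.BalabanUV.T4Continuum.NE7CommutingAverageExp
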